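import Summits.QuantumFields.YangMills.Theses.FradkinShenkerFlow
import Summits.QuantumFields.YangMills.Theorems.FradkinShenkerFlowSusceptibilityToPoincareOrbitSliceSplit
import Summits.QuantumFields.YangMills.Theorems.FradkinShenkerFlowSusceptibilityToPoincareOrbitEfronStein
import Summits.QuantumFields.YangMills.Theorems.FradkinShenkerFlowSusceptibilityToPoincareSiteRotation
import Summits.QuantumFields.YangMills.Theorems.FradkinShenkerFlowSusceptibilityToPoincareHaarResample
import Summits.QuantumFields.YangMills.Theorems.FradkinShenkerFlowSusceptibilityToPoincareDirichletOrbitAverage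
import Literature.Probability.Moments.EfronSteinProofs
import Literature.MathematicalPhysics.QuantumLattice.TorusWilsonGibbs

/-!
# The orbit–slice TRANSFER for crux `SusceptibilityToPoincare` (line `orbit-slice-reduction`)

Route `FradkinShenkerFlow` of `YangMills`, crux item `stmt-QuantumFields-9441`
(`Summit.QuantumFields.YangMills.Theses.FradkinShenkerFlow.SusceptibilityToPoincare`, FS ⇒ UP).

This file assembles the five landed stubs of the line —
`stub_orbitSliceSplit` (orbit–slice splitting of the variance),
`stub_orbitEfronStein` (Efron–Stein on the gauge group),
`stub_siteRotation_le` (a site rotation costs at most the Haar resamplings of its incident links),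
`stub_haarResample_le_heatBath` (Haar resampling ≤ `e^{O(|β|)}` · heat-bath resampling, double counting),
`stub_dirichlet_orbitAverage_le` (orbit averaging contracts the heat-bath Dirichlet form) —
into the TRANSFER THEOREM of the line: for EVERY compact group `G` with a lattice representation `r`, EVERY real `β`,
the uniform single-link heat-bath Poincaré inequality of the 4D torus Wilson measures holds for all bounded measurable
`F` as soon as it holds for the GAUGE-INVARIANT ones (`transfer_upInv_up`, with constant `max C_inv 0 + C_orbit(G,r,β)`,
`C_orbit` independent of the volume). Consequently the crux is EQUIVALENT to its restriction to gauge-invariant test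
functions (`susceptibilityToPoincare_iff_invariant`): every proof or refutation of `SusceptibilityToPoincare` — and of
any re-scoping of it in `G`, `r` or `β`, since the transfer is pointwise in `(G, r, β)` — may work on the invariant
σ-algebra (functions of holonomies) only. "There is no gauge-variant slow mode of the single-link heat bath, at any
coupling, uniformly in the volume" — Elitzur's theorem upgraded from expectations to a spectral statement.

Also recorded: `perVolume_heatBathPoincare` — for each FIXED side the heat-bath Poincaré inequality holds for every compact
`G`, real `β` (Holley–Stroock vs product Haar + Efron–Stein), so the whole content of UP is uniformity in the volume.

## Proof

`Var_μ F = Var_μ F̄ + ∫ Var_π(g ↦ F(U^g)) dμ` (stub 1), `F̄` the orbit average (bounded, measurable, invariant);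
`Var_μ F̄ ≤ C_inv ℰ_hb(F̄) ≤ C_inv ℰ_hb(F)` (hypothesis + stub 3);
`∫ Var_π dμ ≤ ½ Σ_x (site-rotation cost) ≤ ½ C_b Σ_x Σ_{ℓ∋x} (Haar resampling of ℓ) ≤ ½ C_b C_c ℰ_hb(F)` (stubs 2a, 2b, 2c).
-/

noncomputable section

open MeasureTheory ProbabilityTheory
open Literature.MathematicalPhysics.QuantumFieldTheory

namespace Summit.QuantumFields.YangMills.Theorems.SusceptibilityToPoincare

namespace Transfer

/-- Real arithmetic of stubs (2a)–(2c): `V ≤ ½ Σ A`, `A x ≤ C_b B x`, `0 ≤ B x`, `Σ B ≤ C_c E` give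
`V ≤ (½ max C_b 0 · C_c) E`. [folklore] -/
theorem orbit_arith {ι : Type*} [Fintype ι] {V E Cb Cc : ℝ} {A B : ι → ℝ}
    (hV : V ≤ (1 / 2 : ℝ) * ∑ x, A x) (hA : ∀ x, A x ≤ Cb * B x) (hB0 : ∀ x, 0 ≤ B x)
    (hB : ∑ x, B x ≤ Cc * E) : V ≤ ((1 / 2 : ℝ) * (max Cb 0 * Cc)) * E := by
  have h1 : ∀ x, A x ≤ max Cb 0 * B x := fun x =>
    (hA x).trans (mul_le_mul_of_nonneg_right (le_max_left _ _) (hB0 x))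
  have h2 : ∑ x, A x ≤ max Cb 0 * ∑ x, B x := by
    rw [Finset.mul_sum]
    exact Finset.sum_le_sum fun x _ => h1 x
  have h3 : max Cb 0 * ∑ x, B x ≤ max Cb 0 * (Cc * E) :=
    mul_le_mul_of_nonneg_left hB (le_max_right _ _)
  nlinarith [hV, h2, h3]

/-- Real arithmetic of the splitting: `V ≤ V' + O`, `O ≤ C₂ E`, `V' ≤ C₁ E'`, `E' ≤ E`, `0 ≤ E'` give
`V ≤ (max C₁ 0 + C₂) E`. [folklore] -/
theorem split_arith {V V' O E E' C₁ C₂ : ℝ} (h₁ : V ≤ V' + O) (h₂ : O ≤ C₂ * E) (h₃ : V' ≤ C₁ * E')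
    (h₄ : E' ≤ E) (h₅ : 0 ≤ E') : V ≤ (max C₁ 0 + C₂) * E := by
  have h₆ : C₁ * E' ≤ max C₁ 0 * E :=
    (mul_le_mul_of_nonneg_right (le_max_left C₁ 0) h₅).trans
      (mul_le_mul_of_nonneg_left h₄ (le_max_right C₁ 0))
  nlinarith [h₁, h₂, h₃, h₆]

/-- **The gauge-variant sector has a volume-uniform heat-bath gap** ("orbit Efron–Stein", the planner's
`stub_gaugeOrbitGap`, from stubs (2a)–(2c)): for every compact `G`, lattice representation `r` and real `β` there is `C`
such that for every side `2S+1` and bounded measurable `F`,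
`∫ Var_π(g ↦ F(U^g)) dμ(U) ≤ C · Σ_ℓ ∫∫ (F U − F(U[ℓ↦g]))² dν_ℓ^U(g) dμ(U)`. [folklore] -/
theorem gaugeOrbitGap (G : Type) [Group G] [TopologicalSpace G] [IsTopologicalGroup G] [CompactSpace G]
    [MeasurableSpace G] [BorelSpace G] (r : LatticeRep G) (β : ℝ) : ∃ C : ℝ, ∀ (S : ℕ)
    (F : GaugeConfig 4 (2 * S + 1) G → ℝ), Measurable F → (∃ M : ℝ, ∀ U, |F U| ≤ M) →
    ∫ U, variance (fun g : Site 4 (2 * S + 1) → G => F (gaugeTransform g U))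
        (Measure.pi fun _ : Site 4 (2 * S + 1) => haarProbability G)
      ∂(wilsonMeasure r.ρ β : Measure (GaugeConfig 4 (2 * S + 1) G)) ≤
    C * ∑ ℓ : Edge 4 (2 * S + 1), ∫ U, ∫ g, (F U - F (Function.update U ℓ g)) ^ 2
      ∂((haarProbability G).tilted (fun g' => -β * wilsonAction r.ρ (Function.update U ℓ g')))
      ∂(wilsonMeasure r.ρ β : Measure (GaugeConfig 4 (2 * S + 1) G)) := by
  obtain ⟨Cb, hCb⟩ := stub_siteRotation_le G r β
  obtain ⟨Cc, hCc⟩ := stub_haarResample_le_heatBath G r β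
  refine ⟨(1 / 2 : ℝ) * (max Cb 0 * Cc), fun S F hF hM => ?_⟩
  refine orbit_arith (stub_orbitEfronStein G r β S F hF hM) (fun x => hCb S F hF hM x) (fun x => ?_)
    (hCc S F hF hM)
  exact Finset.sum_nonneg fun ℓ _ => by
    split_ifs
    · exact integral_nonneg fun _ => integral_nonneg fun _ => sq_nonneg _
    · exact le_rfl

/-- Nonnegativity of the heat-bath Dirichlet form (sum of integrals of integrals of squares). [folklore] -/
theorem hbForm_nonneg {G : Type} [Group G] [TopologicalSpace G] [IsTopologicalGroup G] [CompactSpace G]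
    [MeasurableSpace G] [BorelSpace G] (r : LatticeRep G) (β : ℝ) (S : ℕ)
    (F : GaugeConfig 4 (2 * S + 1) G → ℝ) :
    0 ≤ ∑ ℓ : Edge 4 (2 * S + 1), ∫ U, ∫ g, (F U - F (Function.update U ℓ g)) ^ 2
        ∂((haarProbability G).tilted (fun g' => -β * wilsonAction r.ρ (Function.update U ℓ g')))
        ∂(wilsonMeasure r.ρ β : Measure (GaugeConfig 4 (2 * S + 1) G)) :=
  Finset.sum_nonneg fun _ _ => integral_nonneg fun _ => integral_nonneg fun _ => sq_nonneg _

/-- **Integration against a tilted probability measure is dominated by integration against the untilted one**: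
for a probability measure `κ`, a measurable tilt `f` with `e^{f}` integrable and oscillation at most `c`, and a bounded
measurable `ψ ≥ 0`, `∫ ψ d(κ.tilted f) ≤ e^{c} ∫ ψ dκ` (the density is at most `e^{c}`). [folklore] -/
theorem integral_tilted_le_exp_mul_integral {K : Type*} [MeasurableSpace K] {κ : Measure K}
    [IsProbabilityMeasure κ] {f : K → ℝ} {c : ℝ}
    (hfi : Integrable (fun h => Real.exp (f h)) κ) (hosc : ∀ h h', f h' ≤ f h + c) {ψ : K → ℝ}
    (hψ : Measurable ψ) (hψ0 : ∀ h, 0 ≤ ψ h) {B : ℝ} (hψB : ∀ h, ψ h ≤ B) :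
    ∫ h, ψ h ∂(κ.tilted f) ≤ Real.exp c * ∫ h, ψ h ∂κ := by
  rw [integral_tilted, ← integral_const_mul]
  have hdens' : ∀ h, Real.exp (f h) / ∫ h', Real.exp (f h') ∂κ ≤ Real.exp c :=
    HaarResample.exp_div_integral_le_exp hfi hosc
  have hint : Integrable (fun h => Real.exp c * ψ h) κ := by
    refine Integrable.of_bound (hψ.const_mul _).aestronglyMeasurable (Real.exp c * B)
      (ae_of_all _ fun h => ?_)
    rw [Real.norm_eq_abs, abs_of_nonneg (mul_nonneg (Real.exp_pos _).le (hψ0 h))]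
    exact mul_le_mul_of_nonneg_left (hψB h) (Real.exp_pos _).le
  refine integral_mono_of_nonneg (ae_of_all _ fun h => ?_) hint (ae_of_all _ fun h => ?_)
  · exact smul_nonneg (div_nonneg (Real.exp_pos _).le (integral_nonneg fun _ => (Real.exp_pos _).le))
      (hψ0 h)
  · simp only [smul_eq_mul]
    exact mul_le_mul_of_nonneg_right (hdens' h) (hψ0 h)

end Transfer

/-- **TRANSFER THEOREM of the line `orbit-slice-reduction`** (registered stub `transfer_upInv_up` of crux
stmt-QuantumFields-9441): for EVERY compact group `G` with a lattice representation `r` and EVERY real `β`, if the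
uniform single-link heat-bath Poincaré inequality of the torus Wilson measures `μ_{β,S} = wilsonMeasure r.ρ β` holds with
some constant for all GAUGE-INVARIANT bounded measurable `F` (UP_inv), then it holds, with another volume-independent
constant, for ALL bounded measurable `F` (UP): `Var F = Var F̄ + ∫ Var_π(F(U^·)) dμ` (orbit–slice splitting,
`stub_orbitSliceSplit`), UP_inv for the orbit average `F̄` plus `ℰ_hb(F̄) ≤ ℰ_hb(F)` (`stub_dirichlet_orbitAverage_le`),
and the orbit gap `∫ Var_π dμ ≤ C_orbit ℰ_hb(F)` (`Transfer.gaugeOrbitGap` from `stub_orbitEfronStein`,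
`stub_siteRotation_le`, `stub_haarResample_le_heatBath`). [folklore] -/
theorem transfer_upInv_up :
    ∀ (G : Type) [Group G] [TopologicalSpace G] [IsTopologicalGroup G] [CompactSpace G]
      [MeasurableSpace G] [BorelSpace G] (r : LatticeRep G) (β : ℝ),
      (∃ C : ℝ, ∀ S : ℕ, ∀ F : GaugeConfig 4 (2 * S + 1) G → ℝ, Measurable F → (∃ M : ℝ, ∀ U, |F U| ≤ M) →
        IsGaugeInvariant F →
        variance F (wilsonMeasure r.ρ β : Measure (GaugeConfig 4 (2 * S + 1) G)) ≤
          C * ∑ ℓ : Edge 4 (2 * S + 1), ∫ U, ∫ g, (F U - F (Function.update U ℓ g)) ^ 2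
            ∂((haarProbability G).tilted (fun g' => -β * wilsonAction r.ρ (Function.update U ℓ g')))
            ∂(wilsonMeasure r.ρ β : Measure (GaugeConfig 4 (2 * S + 1) G))) →
      ∃ C : ℝ, ∀ S : ℕ, ∀ F : GaugeConfig 4 (2 * S + 1) G → ℝ, Measurable F → (∃ M : ℝ, ∀ U, |F U| ≤ M) →
        variance F (wilsonMeasure r.ρ β : Measure (GaugeConfig 4 (2 * S + 1) G)) ≤
          C * ∑ ℓ : Edge 4 (2 * S + 1), ∫ U, ∫ g, (F U - F (Function.update U ℓ g)) ^ 2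
            ∂((haarProbability G).tilted (fun g' => -β * wilsonAction r.ρ (Function.update U ℓ g')))
            ∂(wilsonMeasure r.ρ β : Measure (GaugeConfig 4 (2 * S + 1) G)) := by
  intro G _ _ _ _ _ _ r β hinv
  obtain ⟨C₁, hC₁⟩ := hinv
  obtain ⟨C₂, hC₂⟩ := Transfer.gaugeOrbitGap G r β
  refine ⟨max C₁ 0 + C₂, fun S F hF hbd => ?_⟩
  obtain ⟨M, hM⟩ := hbd
  obtain ⟨hmeas, hbdd, hginv, hsplit⟩ := stub_orbitSliceSplit G r β S F hF M hM
  have horb := hC₂ S F hF ⟨M, hM⟩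
  have hbar := hC₁ S (fun U : GaugeConfig 4 (2 * S + 1) G =>
      ∫ g, F (gaugeTransform g U) ∂(Measure.pi fun _ : Site 4 (2 * S + 1) => haarProbability G))
    hmeas ⟨M, hbdd⟩ hginv
  have hdir := stub_dirichlet_orbitAverage_le G r β S F hF ⟨M, hM⟩
  have hnn := Transfer.hbForm_nonneg r β S (fun U : GaugeConfig 4 (2 * S + 1) G =>
      ∫ g, F (gaugeTransform g U) ∂(Measure.pi fun _ : Site 4 (2 * S + 1) => haarProbability G))
  exact Transfer.split_arith hsplit horb hbar hdir hnn

/-- **UP ⇔ UP_inv** pointwise in `(G, r, β)`: the uniform heat-bath Poincaré inequality for all bounded measurable test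
functions is equivalent to the one for gauge-invariant test functions (the converse direction is trivial). [folklore] -/
theorem up_iff_upInv (G : Type) [Group G] [TopologicalSpace G] [IsTopologicalGroup G] [CompactSpace G]
    [MeasurableSpace G] [BorelSpace G] (r : LatticeRep G) (β : ℝ) :
    (∃ C : ℝ, ∀ S : ℕ, ∀ F : GaugeConfig 4 (2 * S + 1) G → ℝ, Measurable F → (∃ M : ℝ, ∀ U, |F U| ≤ M) →
        variance F (wilsonMeasure r.ρ β : Measure (GaugeConfig 4 (2 * S + 1) G)) ≤
          C * ∑ ℓ : Edge 4 (2 * S + 1), ∫ U, ∫ g, (F U - F (Function.update U ℓ g)) ^ 2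
            ∂((haarProbability G).tilted (fun g' => -β * wilsonAction r.ρ (Function.update U ℓ g')))
            ∂(wilsonMeasure r.ρ β : Measure (GaugeConfig 4 (2 * S + 1) G))) ↔
    (∃ C : ℝ, ∀ S : ℕ, ∀ F : GaugeConfig 4 (2 * S + 1) G → ℝ, Measurable F → (∃ M : ℝ, ∀ U, |F U| ≤ M) →
        IsGaugeInvariant F →
        variance F (wilsonMeasure r.ρ β : Measure (GaugeConfig 4 (2 * S + 1) G)) ≤
          C * ∑ ℓ : Edge 4 (2 * S + 1), ∫ U, ∫ g, (F U - F (Function.update U ℓ g)) ^ 2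
            ∂((haarProbability G).tilted (fun g' => -β * wilsonAction r.ρ (Function.update U ℓ g')))
            ∂(wilsonMeasure r.ρ β : Measure (GaugeConfig 4 (2 * S + 1) G))) :=
  ⟨fun ⟨C, hC⟩ => ⟨C, fun S F hF hM _ => hC S F hF hM⟩, transfer_upInv_up G r β⟩

/-- **The crux is equivalent to its invariant form.** `SusceptibilityToPoincare` (FS ⇒ UP for every compact simple
Lie `G`, faithful unitary `r`, `β ≥ 0`) holds iff the same implication holds with UP demanded only for GAUGE-INVARIANT
bounded measurable `F` — so its infrared content, and any counterexample, lives on the invariant σ-algebra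
(cf. the conditional refutations `Negative/FalseOfTwistSectorInputs.lean`, whose witnesses are invariant events). [folklore] -/
theorem susceptibilityToPoincare_iff_invariant :
    Summit.QuantumFields.YangMills.Theses.FradkinShenkerFlow.SusceptibilityToPoincare ↔
      ∀ (G : Type) [Group G] [TopologicalSpace G] [IsTopologicalGroup G] [CompactSpace G]
        [MeasurableSpace G] [BorelSpace G], IsCompactSimpleLieGroup G →
        ∀ (r : LatticeRep G) (β : ℝ), 0 ≤ β →
        (∀ A B : YMSpecies G, ∃ χ : ℝ, ∀ S : ℕ, ∑ x ∈ Literature.Probability.LatticeModels.box 4 S,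
          |covariance (fun U => A.F (Literature.MathematicalPhysics.QuantumLattice.torusLift (2 * S + 1) U))
            (fun U => B.F (Literature.MathematicalPhysics.QuantumLattice.configShift (-x)
            (Literature.MathematicalPhysics.QuantumLattice.torusLift (2 * S + 1) U)))
            (wilsonMeasure r.ρ β : Measure (GaugeConfig 4 (2 * S + 1) G))| ≤ χ) →
        ∃ C : ℝ, ∀ S : ℕ, ∀ F : GaugeConfig 4 (2 * S + 1) G → ℝ, Measurable F → (∃ M : ℝ, ∀ U, |F U| ≤ M) →
          IsGaugeInvariant F →
          variance F (wilsonMeasure r.ρ β : Measure (GaugeConfig 4 (2 * S + 1) G)) ≤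
            C * ∑ ℓ : Edge 4 (2 * S + 1), ∫ U, ∫ g, (F U - F (Function.update U ℓ g)) ^ 2
              ∂((haarProbability G).tilted (fun g' => -β * wilsonAction r.ρ (Function.update U ℓ g')))
              ∂(wilsonMeasure r.ρ β : Measure (GaugeConfig 4 (2 * S + 1) G)) := by
  refine ⟨fun h G _ _ _ _ _ _ hG r β hβ hFS => ?_, fun h G _ _ _ _ _ _ hG r β hβ hFS => ?_⟩
  · exact ((up_iff_upInv G r β).1 (h G hG r β hβ hFS))
  · exact transfer_upInv_up G r β (h G hG r β hβ hFS)

/-- **The transfer applies verbatim to the WEAK-COUPLING, SIMPLY-CONNECTED re-scoping of the crux** (the repaired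
statement `C′` recommended by the line lead and the crux's refuters: `SimplyConnectedSpace G` and a threshold `β₁(G, r)`):
FS ⇒ UP for `β ≥ β₁` holds for all bounded measurable test functions iff it holds for the gauge-invariant ones — because
`transfer_upInv_up` is pointwise in `(G, r, β)`. Recorded so that a re-scoped crux can import this reduction unchanged. [folklore] -/
theorem weakCouplingSC_iff_invariant :
    (∀ (G : Type) [Group G] [TopologicalSpace G] [IsTopologicalGroup G] [CompactSpace G]
        [MeasurableSpace G] [BorelSpace G], IsCompactSimpleLieGroup G → SimplyConnectedSpace G →
        ∀ (r : LatticeRep G), ∃ β₁ : ℝ, ∀ β : ℝ, β₁ ≤ β →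
        (∀ A B : YMSpecies G, ∃ χ : ℝ, ∀ S : ℕ, ∑ x ∈ Literature.Probability.LatticeModels.box 4 S,
          |covariance (fun U => A.F (Literature.MathematicalPhysics.QuantumLattice.torusLift (2 * S + 1) U))
            (fun U => B.F (Literature.MathematicalPhysics.QuantumLattice.configShift (-x)
            (Literature.MathematicalPhysics.QuantumLattice.torusLift (2 * S + 1) U)))
            (wilsonMeasure r.ρ β : Measure (GaugeConfig 4 (2 * S + 1) G))| ≤ χ) →
        ∃ C : ℝ, ∀ S : ℕ, ∀ F : GaugeConfig 4 (2 * S + 1) G → ℝ, Measurable F → (∃ M : ℝ, ∀ U, |F U| ≤ M) →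
          variance F (wilsonMeasure r.ρ β : Measure (GaugeConfig 4 (2 * S + 1) G)) ≤
            C * ∑ ℓ : Edge 4 (2 * S + 1), ∫ U, ∫ g, (F U - F (Function.update U ℓ g)) ^ 2
              ∂((haarProbability G).tilted (fun g' => -β * wilsonAction r.ρ (Function.update U ℓ g')))
              ∂(wilsonMeasure r.ρ β : Measure (GaugeConfig 4 (2 * S + 1) G))) ↔
    (∀ (G : Type) [Group G] [TopologicalSpace G] [IsTopologicalGroup G] [CompactSpace G]
        [MeasurableSpace G] [BorelSpace G], IsCompactSimpleLieGroup G → SimplyConnectedSpace G →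
        ∀ (r : LatticeRep G), ∃ β₁ : ℝ, ∀ β : ℝ, β₁ ≤ β →
        (∀ A B : YMSpecies G, ∃ χ : ℝ, ∀ S : ℕ, ∑ x ∈ Literature.Probability.LatticeModels.box 4 S,
          |covariance (fun U => A.F (Literature.MathematicalPhysics.QuantumLattice.torusLift (2 * S + 1) U))
            (fun U => B.F (Literature.MathematicalPhysics.QuantumLattice.configShift (-x)
            (Literature.MathematicalPhysics.QuantumLattice.torusLift (2 * S + 1) U)))
            (wilsonMeasure r.ρ β : Measure (GaugeConfig 4 (2 * S + 1) G))| ≤ χ) →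
        ∃ C : ℝ, ∀ S : ℕ, ∀ F : GaugeConfig 4 (2 * S + 1) G → ℝ, Measurable F → (∃ M : ℝ, ∀ U, |F U| ≤ M) →
          IsGaugeInvariant F →
          variance F (wilsonMeasure r.ρ β : Measure (GaugeConfig 4 (2 * S + 1) G)) ≤
            C * ∑ ℓ : Edge 4 (2 * S + 1), ∫ U, ∫ g, (F U - F (Function.update U ℓ g)) ^ 2
              ∂((haarProbability G).tilted (fun g' => -β * wilsonAction r.ρ (Function.update U ℓ g')))
              ∂(wilsonMeasure r.ρ β : Measure (GaugeConfig 4 (2 * S + 1) G))) := by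
  refine ⟨fun h G _ _ _ _ _ _ hG hSC r => ?_, fun h G _ _ _ _ _ _ hG hSC r => ?_⟩
  · obtain ⟨β₁, hβ₁⟩ := h G hG hSC r
    exact ⟨β₁, fun β hβ hFS => (up_iff_upInv G r β).1 (hβ₁ β hβ hFS)⟩
  · obtain ⟨β₁, hβ₁⟩ := h G hG hSC r
    exact ⟨β₁, fun β hβ hFS => transfer_upInv_up G r β (hβ₁ β hβ hFS)⟩

/-- **Per-volume heat-bath Poincaré inequality** (the crux's conclusion for each FIXED side, with a volume-dependent
constant): for every compact `G` with a lattice representation `r`, real `β` and side `2S+1` there is `C = C(G,r,β,S)`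
(of order `e^{O(|β|·#plaquettes)}`) such that `Var_{μ_{β,S}} F ≤ C · Σ_ℓ ∫∫ (F U − F(U[ℓ↦g]))² dν_ℓ^U dμ_{β,S}` for all
bounded measurable `F`. Proof: `μ_{β,S} = (Haar^{⊗E}).tilted(−βS_W)` (`wilsonMeasure_eq_tilted_pi`) with `|βS_W| ≤ |β|B_S`,
so Holley–Stroock comparison with the product Haar measure costs `e^{2|β|B_S}` each way; Efron–Stein for the product
measure (`EfronSteinInequality_holds`); and Haar resampling of a link is dominated by heat-bath resampling
(`HaarResample.integral_haar_le_exp_mul_integral_heatBath`). Hence the ENTIRE content of the uniform inequality UP is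
uniformity in `S`. [folklore] -/
theorem perVolume_heatBathPoincare (G : Type) [Group G] [TopologicalSpace G] [IsTopologicalGroup G]
    [CompactSpace G] [MeasurableSpace G] [BorelSpace G] (r : LatticeRep G) (β : ℝ) (S : ℕ) :
    ∃ C : ℝ, ∀ F : GaugeConfig 4 (2 * S + 1) G → ℝ, Measurable F → (∃ M : ℝ, ∀ U, |F U| ≤ M) →
      variance F (wilsonMeasure r.ρ β : Measure (GaugeConfig 4 (2 * S + 1) G)) ≤
        C * ∑ ℓ : Edge 4 (2 * S + 1), ∫ U, ∫ g, (F U - F (Function.update U ℓ g)) ^ 2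
          ∂((haarProbability G).tilted (fun g' => -β * wilsonAction r.ρ (Function.update U ℓ g')))
          ∂(wilsonMeasure r.ρ β : Measure (GaugeConfig 4 (2 * S + 1) G)) := by
  haveI : SecondCountableTopology G :=
    (r.continuous.isClosedEmbedding r.injective).isEmbedding.secondCountableTopology
  haveI : IsProbabilityMeasure (wilsonMeasure (d := 4) (L := 2 * S + 1) r.ρ β) :=
    isProbabilityMeasure_wilsonMeasure (d := 4) (L := 2 * S + 1) r.ρ r.continuous β
  -- notation
  set μ : Measure (GaugeConfig 4 (2 * S + 1) G) := wilsonMeasure r.ρ β with hμdef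
  set πE : Measure (GaugeConfig 4 (2 * S + 1) G) :=
    Measure.pi fun _ : Edge 4 (2 * S + 1) => haarProbability G with hπE
  set f : GaugeConfig 4 (2 * S + 1) G → ℝ := fun U => -β * wilsonAction r.ρ U with hf
  have hμ : μ = πE.tilted f :=
    Literature.MathematicalPhysics.QuantumLattice.wilsonMeasure_eq_tilted_pi r.ρ r.continuous β
  -- the tilt is bounded, hence of bounded oscillation
  obtain ⟨B, hB⟩ := exists_abs_wilsonAction_le (d := 4) (L := 2 * S + 1) r.ρ r.continuous
  have hfm : Measurable f := (measurable_wilsonAction r.ρ r.continuous).const_mul _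
  have hfb : ∀ U, |f U| ≤ |β| * B := fun U => by
    rw [hf, abs_mul, abs_neg]
    exact mul_le_mul_of_nonneg_left (hB U) (abs_nonneg _)
  have hosc : ∀ U U', f U' ≤ f U + 2 * (|β| * B) := fun U U' => by
    have h1 := (abs_le.1 (hfb U)).1
    have h2 := (abs_le.1 (hfb U')).2
    linarith
  have hfi : Integrable (fun U => Real.exp (f U)) πE := by
    refine Integrable.of_bound (Real.measurable_exp.comp hfm).aestronglyMeasurable
      (Real.exp (|β| * B)) (ae_of_all _ fun U => ?_)
    rw [Real.norm_eq_abs, Real.abs_exp]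
    exact Real.exp_le_exp.2 (abs_le.1 (hfb U)).2
  -- trace bound for the heat-bath comparison
  obtain ⟨Mt, hMt0, hMt⟩ := exists_bound_trace_re_nonneg r.ρ r.continuous
  set c₁ : ℝ := 2 * (|β| * B) with hc₁
  set c₂ : ℝ := |β| * (2 * ((((4 + 1) * Fintype.card {q : Fin 4 × Fin 4 // q.1 < q.2} : ℕ) : ℝ) *
        ((r.N : ℝ) + Mt))) with hc₂
  refine ⟨Real.exp c₁ * ((1 / 2 : ℝ) * (Real.exp c₁ * Real.exp c₂)), fun F hF hbd => ?_⟩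
  obtain ⟨M, hM⟩ := hbd
  -- abbreviations for the resampling costs
  set Hhb : Edge 4 (2 * S + 1) → ℝ := fun ℓ => ∫ U, ∫ g, (F U - F (Function.update U ℓ g)) ^ 2
      ∂((haarProbability G).tilted (fun g' => -β * wilsonAction r.ρ (Function.update U ℓ g'))) ∂μ with hHhb
  set Hμ : Edge 4 (2 * S + 1) → ℝ := fun ℓ => ∫ U, ∫ h, (F U - F (Function.update U ℓ h)) ^ 2
      ∂(haarProbability G) ∂μ with hHμ
  set Hπ : Edge 4 (2 * S + 1) → ℝ := fun ℓ => ∫ U, ∫ h, (F U - F (Function.update U ℓ h)) ^ 2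
      ∂(haarProbability G) ∂πE with hHπ
  -- the one-link Haar resampling cost is a bounded measurable nonnegative function of `U`
  have hsq_meas : ∀ ℓ : Edge 4 (2 * S + 1), Measurable fun p : GaugeConfig 4 (2 * S + 1) G × G =>
      (F p.1 - F (Function.update p.1 ℓ p.2)) ^ 2 := fun ℓ =>
    ((hF.comp measurable_fst).sub (hF.comp measurable_update')).pow_const 2
  have hψm : ∀ ℓ, Measurable fun U : GaugeConfig 4 (2 * S + 1) G =>
      ∫ h, (F U - F (Function.update U ℓ h)) ^ 2 ∂(haarProbability G) := fun ℓ =>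
    ((hsq_meas ℓ).stronglyMeasurable.integral_prod_right' (ν := haarProbability G)).measurable
  have hsq_bd : ∀ (U : GaugeConfig 4 (2 * S + 1) G) (ℓ : Edge 4 (2 * S + 1)) (h : G),
      ‖(F U - F (Function.update U ℓ h)) ^ 2‖ ≤ (2 * M) ^ 2 := fun U ℓ h => by
    rw [norm_pow, Real.norm_eq_abs, ← sq_abs (2 * M)]
    refine pow_le_pow_left₀ (abs_nonneg _) ((abs_sub _ _).trans ?_) 2
    calc |F U| + |F (Function.update U ℓ h)| ≤ M + M := add_le_add (hM _) (hM _)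
      _ = 2 * M := by ring
      _ ≤ |2 * M| := le_abs_self _
  have hψ0 : ∀ ℓ (U : GaugeConfig 4 (2 * S + 1) G),
      0 ≤ ∫ h, (F U - F (Function.update U ℓ h)) ^ 2 ∂(haarProbability G) := fun ℓ U =>
    integral_nonneg fun _ => sq_nonneg _
  have hψB : ∀ ℓ (U : GaugeConfig 4 (2 * S + 1) G),
      ∫ h, (F U - F (Function.update U ℓ h)) ^ 2 ∂(haarProbability G) ≤ (2 * M) ^ 2 := fun ℓ U => by
    have h := norm_integral_le_of_norm_le_const (μ := haarProbability G) (ae_of_all _ (hsq_bd U ℓ))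
    rw [Real.norm_eq_abs, probReal_univ, mul_one] at h
    exact (le_abs_self _).trans h
  -- Step 1: Holley–Stroock, `Var_μ F ≤ e^{c₁} Var_π F`
  have hFiμ : ∀ m : ℝ, ∫ U, (F U - m) ^ 2 ∂μ = variance F μ + ((∫ U, F U ∂μ) - m) ^ 2 := fun m =>
    integral_sub_sq_eq_variance_add_sq hF hM m
  have hFiπ : ∀ m : ℝ, ∫ U, (F U - m) ^ 2 ∂πE = variance F πE + ((∫ U, F U ∂πE) - m) ^ 2 := fun m =>
    integral_sub_sq_eq_variance_add_sq hF hM m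
  have hstep1 : variance F μ ≤ Real.exp c₁ * variance F πE := by
    set m : ℝ := ∫ U, F U ∂πE with hm
    have h1 : variance F μ ≤ ∫ U, (F U - m) ^ 2 ∂μ := by
      rw [hFiμ m]
      nlinarith [sq_nonneg ((∫ U, F U ∂μ) - m)]
    have h2 : ∫ U, (F U - m) ^ 2 ∂μ ≤ Real.exp c₁ * ∫ U, (F U - m) ^ 2 ∂πE := by
      rw [hμ]
      refine Transfer.integral_tilted_le_exp_mul_integral hfi hosc ((hF.sub_const m).pow_const 2)
        (fun U => sq_nonneg _) (B := (|M| + |m|) ^ 2) fun U => ?_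
      rw [← sq_abs (F U - m)]
      exact pow_le_pow_left₀ (abs_nonneg _)
        ((abs_sub _ _).trans (add_le_add ((hM U).trans (le_abs_self M)) le_rfl)) 2
    have h3 : ∫ U, (F U - m) ^ 2 ∂πE = variance F πE := by
      rw [hFiπ m, hm, sub_self]
      ring
    calc variance F μ ≤ ∫ U, (F U - m) ^ 2 ∂μ := h1
      _ ≤ Real.exp c₁ * ∫ U, (F U - m) ^ 2 ∂πE := h2
      _ = Real.exp c₁ * variance F πE := by rw [h3]
  -- Step 2: Efron–Stein for the product Haar measure
  have hL2 : MemLp F 2 πE :=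
    MemLp.of_bound hF.aestronglyMeasurable M (ae_of_all _ fun U => by
      rw [Real.norm_eq_abs]; exact hM U)
  have hstep2 : variance F πE ≤ (1 / 2 : ℝ) * ∑ ℓ, Hπ ℓ :=
    Literature.Probability.Moments.EfronSteinInequality_holds (Edge 4 (2 * S + 1)) (fun _ => G)
      (fun _ => haarProbability G) F hF hL2
  -- Step 3: back to `μ`, `Hπ ℓ ≤ e^{c₁} Hμ ℓ`
  have hstep3 : ∀ ℓ, Hπ ℓ ≤ Real.exp c₁ * Hμ ℓ := fun ℓ => by
    have h := HaarResample.integral_le_exp_mul_integral_tilted (κ := πE) hfm hfi hosc (hψm ℓ) (hψ0 ℓ)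
      (hψB ℓ)
    rw [← hμ] at h
    exact h
  -- Step 4: Haar resampling ≤ e^{c₂} heat-bath resampling
  have hstep4 : ∀ ℓ, Hμ ℓ ≤ Real.exp c₂ * Hhb ℓ := fun ℓ =>
    HaarResample.integral_haar_le_exp_mul_integral_heatBath r β hMt0 hMt S hF hM ℓ
  -- combine
  have hsum : ∑ ℓ, Hπ ℓ ≤ Real.exp c₁ * Real.exp c₂ * ∑ ℓ, Hhb ℓ := by
    rw [Finset.mul_sum]
    refine Finset.sum_le_sum fun ℓ _ => (hstep3 ℓ).trans ?_
    rw [mul_assoc]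
    exact mul_le_mul_of_nonneg_left (hstep4 ℓ) (Real.exp_pos _).le
  calc variance F μ ≤ Real.exp c₁ * variance F πE := hstep1
    _ ≤ Real.exp c₁ * ((1 / 2 : ℝ) * ∑ ℓ, Hπ ℓ) :=
        mul_le_mul_of_nonneg_left hstep2 (Real.exp_pos _).le
    _ ≤ Real.exp c₁ * ((1 / 2 : ℝ) * (Real.exp c₁ * Real.exp c₂ * ∑ ℓ, Hhb ℓ)) := by
        gcongr
    _ = Real.exp c₁ * ((1 / 2 : ℝ) * (Real.exp c₁ * Real.exp c₂)) * ∑ ℓ, Hhb ℓ := by ring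

end Summit.QuantumFields.YangMills.Theorems.SusceptibilityToPoincare

end
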